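import Literature.MathematicalPhysics.KineticTheory.PrefixRungPerturbation
import HarnessLib

/-!
# CEHR §5.1 for the cell block of the prefix cell chain, III: the rescaled driven cell block stays close to the limit chain; dissipation at the left bath

Trunk T-KINETIC (Literature/MathematicalPhysics/KineticTheory). Continuation of
`PrefixRungScaling.lean` / `PrefixRungPerturbation.lean`. Cuneo–Eckmann–Hairer–Rey-Bellet 2018,
§5.1 (Lemma 5.17 and the proof of Prop. 5.3, p. 15): in the rescaled variables (5.7) the driven chain
solves (5.8), whose drift differs from the limit system by `O(1/K)`; Grönwall makes the rescaled path
and the limit solution close, and the dissipation of the limit solution transfers. Here this is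
carried out for the CELL BLOCK `[0, k]` of the MIXED rung `cellChain ω₂ lam β γ (· < k)`
(`0 < k`, `k + 1 ≤ N`; outside CEHR's Condition C3 by their Remark 2.11): the projection
`prefixRungProj` of the rescaled pathwise solution `drivenFlow ((cellChain …).langevinDrift N) x (0, η)`
(ConfinedForcedFlow.lean: the Langevin equation driven by a continuous momentum-noise path `η`)
solves, on the cell block, the limit equation up to a forcing of size `O(1/K)` — the host enters only
through the harmonic bond `k` (`PrefixRungPerturbation.lean`) — so that, along an energy ceiling
`H ≤ c₁K⁴` on the window `[0, Λ/K]` and a noise of size `≤ δ₀K`, every solution `ŷ` of the limit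
cell chain started at the projected rescaled initial point is `O(1/K)`-close to it, and its
left-bath dissipation `∫₀^Λ p̂₀² ≥ ε₁` yields `∫₀^{Λ/K} ȳ₀² ≥ (ε₁/4) K³` for the smooth part
`y = z - (0, η)` of the driven path, once `K ≥ K₀(Λ, δ₀, c₁, h₀, ε₁)`:

* `scalePath_eq_of_integralEq` — the rescaled integral equation for a general drift;
* `prefixRung_abs_fst_le_of_hamiltonian_le` / `prefixRung_abs_fst_host_le` / `prefixRung_abs_snd_le` —
  at energy `≤ c K⁴` the cell positions are `O(K)` (quartic pinning on `[0,k)`, the quartic bond ties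
  `k`), all positions are `O(K²)`, all momenta are `O(K²)`;
* `prefixRung_dissipation_ge_of_limit` — **the dissipation bound in the cell-block regime**, with the
  energy ceiling, the limit solution and its dissipation as displayed hypotheses (supplied, in the
  crux `PrefixSteadyStates`, by the pathwise energy bookkeeping and by Prop. 5.14 for the limit cell
  chain).

## References

* N. Cuneo, J.-P. Eckmann, M. Hairer, L. Rey-Bellet, EJP 23 (2018) no. 55 (arXiv:1712.09413), §5.1:
  (5.7)–(5.12), Lemma 5.8, Lemma 5.17, proof of Prop. 5.3 (p. 15); Remark 2.11.
* E. A. Coddington, N. Levinson, *Theory of Ordinary Differential Equations* (1955), Ch. 1 §5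
  (Grönwall), through `Literature.Analysis.ODE.IsIntegralSolutionOn.norm_sub_le_mul_exp`.
-/

noncomputable section

open MeasureTheory Filter Topology Set Metric Function
open scoped NNReal

namespace Literature.MathematicalPhysics.KineticTheory.HeatConduction

open OscillatorChain Literature.Analysis.ODE Literature.MathematicalPhysics.KineticTheory

/-! ### The rescaled integral equation for a general drift -/

section Rescale

variable {N : ℕ}

/-- **The rescaled integral equation** (CEHR (5.8)) for a general continuous drift `Y`: if
`z(s) = x + (0, η(s)) + ∫₀ˢ Y(z)` on `[0, Λ/K]`, then on `[0, Λ]` the rescaled path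
`z̃(σ) = rescale K (z(σ/K))` satisfies `z̃(σ) = x̃ + (0, K⁻²η(σ/K)) + ∫₀^σ K⁻¹ • rescale K (Y(z(r/K))) dr`.
[cite: CuneoEckmannHairerReyBellet2018, §5.1 eq. (5.8)] -/
theorem scalePath_eq_of_integralEq {Y : PhaseSpace N → PhaseSpace N} (hY : Continuous Y) {K : ℝ}
    (hK : 0 < K) {x : PhaseSpace N} {η : ℝ → Fin N → ℝ} {z : ℝ → PhaseSpace N} (hzc : Continuous z)
    {Λ : ℝ} (hz : ∀ s ∈ Icc 0 (Λ / K), z s = x + ((0 : Fin N → ℝ), η s) + ∫ r in (0 : ℝ)..s, Y (z r))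
    {σ : ℝ} (hσ : σ ∈ Icc 0 Λ) :
    scalePath K z σ = rescale K x + ((0 : Fin N → ℝ), fun i => (K ^ 2)⁻¹ * η (σ / K) i) +
      ∫ r in (0 : ℝ)..σ, K⁻¹ • rescale K (Y (z (r / K))) := by
  have hσK : σ / K ∈ Icc 0 (Λ / K) := ⟨div_nonneg hσ.1 hK.le, div_le_div_of_nonneg_right hσ.2 hK.le⟩
  unfold scalePath
  rw [hz (σ / K) hσK, rescale_add, rescale_add]
  have h1 : rescale K (((0 : Fin N → ℝ), η (σ / K)) : PhaseSpace N) =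
      ((0 : Fin N → ℝ), fun i => (K ^ 2)⁻¹ * η (σ / K) i) := by
    ext i <;> simp [rescale]
  have h2 : rescale K (∫ r in (0 : ℝ)..σ / K, Y (z r)) = ∫ r in (0 : ℝ)..σ / K, rescale K (Y (z r)) := by
    have hint : IntervalIntegrable (fun r => Y (z r)) volume 0 (σ / K) := (hY.comp hzc).intervalIntegrable _ _
    rw [← rescaleL_apply, ← (rescaleL K).intervalIntegral_comp_comm hint]
    simp only [rescaleL_apply]
  have h3 : ∫ r in (0 : ℝ)..σ, K⁻¹ • rescale K (Y (z (r / K))) = ∫ r in (0 : ℝ)..σ / K, rescale K (Y (z r)) := by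
    rw [intervalIntegral.integral_smul, intervalIntegral.inv_smul_integral_comp_div
      (f := fun r => rescale K (Y (z r))), zero_div]
  rw [h1, h2, h3]

end Rescale

/-! ### A-priori size of positions and momenta of the prefix rung at energy `c K⁴` -/

section Apriori

variable {ω₂ lam β γ : ℝ} {k N : ℕ}

/-- **Cell positions are `O(K)` at energy `O(K⁴)`**: for the prefix rung with `ω₂ ≥ 0`, `lam, β > 0`,
`0 < k`, if `H(w) ≤ c K⁴` (`K > 0`, `c ≥ 0`) then `|qᵢ| ≤ 2(max 1 (4c/lam) + max 1 (4c/β)) K` for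
every site `i ≤ k` (the sites `< k` carry the quartic pinning `lam q⁴/4 ≤ H`; the interface site `k`
is tied to `k - 1` by the quartic bond `β r⁴/4 ≤ H`). [folklore] -/
theorem prefixRung_abs_fst_le_of_hamiltonian_le (hω : 0 ≤ ω₂) (hl : 0 < lam) (hβ : 0 < β)
    (hk : 0 < k) {K c : ℝ} (hK : 0 < K) (w : PhaseSpace N)
    (hw : (cellChain ω₂ lam β γ (fun i => decide (i < k))).hamiltonian N w ≤ c * K ^ 4)
    (i : Fin N) (hi : i.val ≤ k) :
    |w.1 i| ≤ 2 * (max 1 (4 * c / lam) + max 1 (4 * c / β)) * K := by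
  set P := cellChain ω₂ lam β γ (fun i => decide (i < k)) with hP
  have hU0 : ∀ j (q : ℝ), 0 ≤ P.U j q := fun j q => by
    show 0 ≤ ω₂ * q ^ 2 / 2 + (if decide (j < k) then lam else 0) * q ^ 4 / 4
    have : 0 ≤ (if decide (j < k) then lam else 0 : ℝ) := by split_ifs <;> linarith
    positivity
  have hV0 : ∀ j (r : ℝ), 0 ≤ P.V j r := fun j r => by
    show 0 ≤ r ^ 2 / 2 + (if decide (j < k) then β else 0) * r ^ 4 / 4
    have : 0 ≤ (if decide (j < k) then β else 0 : ℝ) := by split_ifs <;> linarith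
    positivity
  have hK4 : 0 < K ^ 4 := by positivity
  have hm1 : 1 ≤ max 1 (4 * c / lam) := le_max_left _ _
  have hm2 : 1 ≤ max 1 (4 * c / β) := le_max_left _ _
  -- pinned cell sites
  have hpin : ∀ j : Fin N, j.val < k → |w.1 j| ≤ max 1 (4 * c / lam) * K := by
    intro j hj
    have h1 := SiteChain.site_le_hamiltonian P hU0 hV0 N w j
    have hUj : P.U j.val (w.1 j) = ω₂ * w.1 j ^ 2 / 2 + lam * w.1 j ^ 4 / 4 := by
      show ω₂ * w.1 j ^ 2 / 2 + (if decide (j.val < k) then lam else 0) * w.1 j ^ 4 / 4 = _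
      rw [if_pos (by simpa using hj)]
    rw [hUj] at h1
    have h2 : lam * w.1 j ^ 4 / 4 ≤ c * K ^ 4 := by
      nlinarith [sq_nonneg (w.2 j), mul_nonneg hω (sq_nonneg (w.1 j))]
    have h3 : (w.1 j / K) ^ 4 ≤ 4 * c / lam := by
      rw [div_pow, div_le_div_iff₀ hK4 hl]; nlinarith
    have h4 := abs_le_max_one_of_pow_four_le h3
    rw [abs_div, abs_of_pos hK, div_le_iff₀ hK] at h4
    exact h4
  by_cases hik : i.val < k
  · have := hpin i hik
    nlinarith [abs_nonneg (w.1 i), mul_nonneg (zero_le_one.trans hm2) hK.le]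
  · have hieq : i.val = k := by omega
    obtain ⟨j, hjdef⟩ : ∃ j : Fin N, j = ⟨k - 1, by omega⟩ := ⟨_, rfl⟩
    have hjv : j.val = k - 1 := by rw [hjdef]
    have hj : j.val < k := by omega
    have hji : i.val = j.val + 1 := by omega
    have hb := SiteChain.bond_le_hamiltonian P hU0 hV0 N w hji
    have hVj : P.V j.val (w.1 i - w.1 j) = (w.1 i - w.1 j) ^ 2 / 2 + β * (w.1 i - w.1 j) ^ 4 / 4 := by
      show (w.1 i - w.1 j) ^ 2 / 2 + (if decide (j.val < k) then β else 0) * (w.1 i - w.1 j) ^ 4 / 4 = _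
      rw [if_pos (by simpa using hj)]
    rw [hVj] at hb
    have h2 : β * (w.1 i - w.1 j) ^ 4 / 4 ≤ c * K ^ 4 := by nlinarith [sq_nonneg (w.1 i - w.1 j)]
    have h3 : ((w.1 i - w.1 j) / K) ^ 4 ≤ 4 * c / β := by
      rw [div_pow, div_le_div_iff₀ hK4 hβ]; nlinarith
    have h4 := abs_le_max_one_of_pow_four_le h3
    rw [abs_div, abs_of_pos hK, div_le_iff₀ hK] at h4
    have h5 := hpin j hj
    calc |w.1 i| = |(w.1 i - w.1 j) + w.1 j| := by ring_nf
      _ ≤ |w.1 i - w.1 j| + |w.1 j| := abs_add_le _ _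
      _ ≤ max 1 (4 * c / β) * K + max 1 (4 * c / lam) * K := add_le_add h4 h5
      _ ≤ 2 * (max 1 (4 * c / lam) + max 1 (4 * c / β)) * K := by
          nlinarith [mul_nonneg (zero_le_one.trans hm1) hK.le, mul_nonneg (zero_le_one.trans hm2) hK.le]

/-- **All positions are `O(K²)` at energy `O(K⁴)`** (harmonic pinning `ω₂ q²/2 ≤ H`, `ω₂ > 0`):
`|qᵢ| ≤ max 1 (2c/ω₂) K²`. [folklore] -/
theorem prefixRung_abs_fst_host_le (hω : 0 < ω₂) (hl : 0 ≤ lam) (hβ : 0 ≤ β) (hγ : 0 ≤ γ)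
    {K c : ℝ} (hK : 0 < K) (w : PhaseSpace N)
    (hw : (cellChain ω₂ lam β γ (fun i => decide (i < k))).hamiltonian N w ≤ c * K ^ 4) (i : Fin N) :
    |w.1 i| ≤ max 1 (2 * c / ω₂) * K ^ 2 := by
  set P := cellChain ω₂ lam β γ (fun i => decide (i < k)) with hP
  have hUC := cellChain_uniformlyConfining hω hl hβ hγ (fun i => decide (i < k))
  have h1 := SiteChain.site_le_hamiltonian P hUC.U_nonneg hUC.V_nonneg N w i
  have hUi : ω₂ * w.1 i ^ 2 / 2 ≤ P.U i.val (w.1 i) := by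
    show ω₂ * w.1 i ^ 2 / 2 ≤ ω₂ * w.1 i ^ 2 / 2 + (if decide (i.val < k) then lam else 0) * w.1 i ^ 4 / 4
    have : 0 ≤ (if decide (i.val < k) then lam else 0 : ℝ) := by split_ifs <;> linarith
    have h4 : 0 ≤ w.1 i ^ 4 := by positivity
    nlinarith
  have hK2 : 0 < K ^ 2 := by positivity
  have h2 : ω₂ * w.1 i ^ 2 / 2 ≤ c * K ^ 4 := by nlinarith [sq_nonneg (w.2 i)]
  have h3 : (w.1 i / K ^ 2) ^ 2 ≤ 2 * c / ω₂ := by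
    rw [div_pow, div_le_div_iff₀ (by positivity) hω]; nlinarith
  have h4 : |w.1 i / K ^ 2| ≤ max 1 (2 * c / ω₂) := by
    rcases le_or_gt |w.1 i / K ^ 2| 1 with h | h
    · exact h.trans (le_max_left _ _)
    · refine le_max_of_le_right ?_
      have e : |w.1 i / K ^ 2| ^ 2 = (w.1 i / K ^ 2) ^ 2 := sq_abs _
      nlinarith [abs_nonneg (w.1 i / K ^ 2)]
  rw [abs_div, abs_of_pos hK2, div_le_iff₀ hK2] at h4
  exact h4

/-- **All momenta are `O(K²)` at energy `O(K⁴)`**: `|pᵢ| ≤ max 1 (2c) K²`. [folklore] -/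
theorem prefixRung_abs_snd_le (hω : 0 < ω₂) (hl : 0 ≤ lam) (hβ : 0 ≤ β) (hγ : 0 ≤ γ)
    {K c : ℝ} (hK : 0 < K) (w : PhaseSpace N)
    (hw : (cellChain ω₂ lam β γ (fun i => decide (i < k))).hamiltonian N w ≤ c * K ^ 4) (i : Fin N) :
    |w.2 i| ≤ max 1 (2 * c) * K ^ 2 := by
  set P := cellChain ω₂ lam β γ (fun i => decide (i < k)) with hP
  have hUC := cellChain_uniformlyConfining hω hl hβ hγ (fun i => decide (i < k))
  have h1 := SiteChain.site_le_hamiltonian P hUC.U_nonneg hUC.V_nonneg N w i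
  have hK2 : 0 < K ^ 2 := by positivity
  have h2 : w.2 i ^ 2 / 2 ≤ c * K ^ 4 := by linarith [hUC.U_nonneg i.val (w.1 i)]
  have h3 : (w.2 i / K ^ 2) ^ 2 ≤ 2 * c := by
    rw [div_pow, div_le_iff₀ (by positivity)]; nlinarith
  have h4 : |w.2 i / K ^ 2| ≤ max 1 (2 * c) := by
    rcases le_or_gt |w.2 i / K ^ 2| 1 with h | h
    · exact h.trans (le_max_left _ _)
    · refine le_max_of_le_right ?_
      have e : |w.2 i / K ^ 2| ^ 2 = (w.2 i / K ^ 2) ^ 2 := sq_abs _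
      nlinarith [abs_nonneg (w.2 i / K ^ 2)]
  rw [abs_div, abs_of_pos hK2, div_le_iff₀ hK2] at h4
  exact h4

end Apriori

/-! ### The closeness of the rescaled cell block to the limit chain, and the dissipation it inherits -/

section Closeness

/- The limit cell chain of the prefix rung, as a structure literal (notation only, as in
`PrefixRungScaling.lean`). -/
set_option quotPrecheck false in
local notation "P₀⟦" lam ", " β ", " k "⟧" =>
  (SiteChain.mk (fun i q => (if i < k then lam else 0) * q ^ 4 / 4) (fun _ r => β * r ^ 4 / 4) 0)

variable {ω₂ lam β γ : ℝ} {k N : ℕ}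

set_option maxHeartbeats 800000 in
/-- **The dissipation bound in the cell-block regime** (CEHR Prop. 5.3 / Lemma 5.17 on the cell block
of the mixed rung). Data: the prefix rung `cellChain ω₂ lam β γ (· < k)` with `ω₂, lam, β > 0`,
`γ ≥ 0`, `0 < k`, `k + 1 ≤ N`; a window `Λ > 0`, a noise size `δ₀ > 0`, an energy ceiling constant
`c₁`, an energy bound `h₀` for the limit solution and a dissipation level `ε₁ > 0`. Then there is
`K₀ ≥ 1` such that for `K ≥ K₀`, every start `x`, every continuous momentum-noise path `η` with
`‖η‖ ≤ δ₀K` on `[0, Λ/K]` such that the smooth part `y = z - (0, η)` of the driven path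
`z = drivenFlow Y x (0, η)` stays below `c₁K⁴` in energy on the window, and every continuous solution
`ŷ` on `[0, Λ]` of the limit cell chain started at the cell block of `rescale K x`, of energy `≤ h₀`
along `[0, Λ]` and left-bath dissipation `∫₀^Λ p̂₀² ≥ ε₁`, one has `∫₀^{Λ/K} ȳ₀(s)² ds ≥ (ε₁/4) K³`.
Proof: the rescaled integral equation projected on the cell block is the limit equation with a
forcing `O(1/K)` (the perturbation lemma on the region given by the a-priori bounds, the noise
`K⁻²η = O(δ₀/K)`), Grönwall with the Lipschitz constant of the limit drift, and
`∫(K⁻²ȳ₀(σ/K))² ≥ ½∫p̂₀² - Λ·O(1/K²)`, rescaled back (`∫₀^{Λ/K} ȳ₀² = K³∫₀^Λ (K⁻²ȳ₀(σ/K))² dσ`).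
[cite: CuneoEckmannHairerReyBellet2018, Lemma 5.17 and proof of Prop 5.3] -/
theorem prefixRung_dissipation_ge_of_limit (hω : 0 < ω₂) (hl : 0 < lam) (hβ : 0 < β) (hγ : 0 ≤ γ)
    (hk : 0 < k) (hkN : k + 1 ≤ N) {Λ δ₀ c₁ h₀ ε₁ : ℝ} (hΛ : 0 < Λ) (hδ₀ : 0 < δ₀) (hε₁ : 0 < ε₁) :
    ∃ K₀ : ℝ, 1 ≤ K₀ ∧ ∀ K : ℝ, K₀ ≤ K → ∀ (x : PhaseSpace N) (η : ℝ → Fin N → ℝ), Continuous η →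
      (∀ s ∈ Icc 0 (Λ / K), ‖η s‖ ≤ δ₀ * K) →
      (∀ s ∈ Icc 0 (Λ / K), (cellChain ω₂ lam β γ (fun i => decide (i < k))).hamiltonian N
        (drivenFlow ((cellChain ω₂ lam β γ (fun i => decide (i < k))).langevinDrift N) x
          (fun s => ((0 : Fin N → ℝ), η s)) s - ((0 : Fin N → ℝ), η s)) ≤ c₁ * K ^ 4) →
      ∀ yh : ℝ → PhaseSpace (k + 1), Continuous yh →
        yh 0 = prefixRungProj k N hkN (rescale K x) →
        (∀ σ ∈ Ioo 0 Λ, HasDerivAt yh (SiteChain.langevinDrift P₀⟦lam, β, k⟧ (k + 1) (yh σ)) σ) →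
        (∀ σ ∈ Icc 0 Λ, P₀⟦lam, β, k⟧.hamiltonian (k + 1) (yh σ) ≤ h₀) →
        ε₁ ≤ ∫ σ in (0 : ℝ)..Λ, (yh σ).2 ⟨0, Nat.succ_pos k⟩ ^ 2 →
        ε₁ / 4 * K ^ 3 ≤ ∫ s in (0 : ℝ)..Λ / K,
          (drivenFlow ((cellChain ω₂ lam β γ (fun i => decide (i < k))).langevinDrift N) x
              (fun s => ((0 : Fin N → ℝ), η s)) s - ((0 : Fin N → ℝ), η s)).2 ⟨0, by omega⟩ ^ 2 := by
  set P := cellChain ω₂ lam β γ (fun i => decide (i < k)) with hP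
  have hUC := cellChain_uniformlyConfining hω hl.le hβ.le hγ (fun i => decide (i < k))
  -- the constants: the region
  set Cq : ℝ := 2 * (max 1 (4 * c₁ / lam) + max 1 (4 * c₁ / β)) + 2 * (max 1 (4 * h₀ / lam) + max 1 (4 * h₀ / β))
    with hCq
  have hCq0 : 0 ≤ Cq := by
    have := le_max_left 1 (4 * c₁ / lam); have := le_max_left 1 (4 * c₁ / β)
    have := le_max_left 1 (4 * h₀ / lam); have := le_max_left 1 (4 * h₀ / β)
    rw [hCq]; linarith
  set Ch : ℝ := max 1 (2 * c₁ / ω₂) with hCh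
  have hCh0 : 0 ≤ Ch := zero_le_one.trans (le_max_left _ _)
  set Cp : ℝ := max 1 (2 * c₁) + δ₀ + max 1 (2 * h₀) with hCp
  have hCp0 : 0 ≤ Cp := by
    have := le_max_left 1 (2 * c₁); have := le_max_left 1 (2 * h₀); rw [hCp]; linarith
  set L : ℝ := 1 + 3 * lam * Cq ^ 2 + 48 * β * Cq ^ 2 with hL
  have hL0 : 0 ≤ L := by rw [hL]; positivity
  set Cpert : ℝ := ω₂ * Cq + 4 * Cq + Ch + 2 * γ * Cp with hCpert
  have hCpert0 : 0 ≤ Cpert := by rw [hCpert]; positivity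
  set D₀ : ℝ := (δ₀ + Λ * Cpert) * Real.exp (L * Λ) + δ₀ with hD₀
  have hD₀0 : 0 ≤ D₀ := by rw [hD₀]; positivity
  set K₀ : ℝ := max 1 (8 * Λ * D₀ ^ 2 / ε₁ + 1) with hK₀
  refine ⟨K₀, le_max_left _ _, ?_⟩
  intro K hK x η hη hM hceil yh hyhc hyh0 hyhd hyhE hdiss
  have hK1 : 1 ≤ K := (le_max_left _ _).trans hK
  have hK0 : 0 < K := by linarith
  have hKD : 8 * Λ * D₀ ^ 2 / ε₁ ≤ K := by
    have := (le_max_right _ _).trans hK; linarith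
  -- the objects
  set Y := P.langevinDrift N with hY
  have hYc : Continuous Y := hUC.continuous_langevinDrift N
  set nz : ℝ → PhaseSpace N := fun s => ((0 : Fin N → ℝ), η s) with hnz
  have hnzc : Continuous nz := continuous_const.prodMk hη
  have hnzS : ∀ s, nz s ∈ (hUC.confinedDrift N).noise := fun s => by
    rw [SiteChain.UniformlyConfining.confinedDrift_noise]; exact mem_momentumSubspace.2 rfl
  set z : ℝ → PhaseSpace N := drivenFlow Y x nz with hz
  have hzc : Continuous z := (hUC.confinedDrift N).toConfinedDrift.continuous_flow x hnzc hnzS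
  have hzIE : ∀ s ∈ Icc 0 (Λ / K), z s = x + ((0 : Fin N → ℝ), η s) + ∫ r in (0 : ℝ)..s, Y (z r) :=
    fun s hs => (hUC.confinedDrift N).toConfinedDrift.isIntegralSolutionOn_flow x hnzc hnzS (Λ / K) s hs
  set xs := rescale K x with hxs
  set zs := scalePath K z with hzs
  have hzsc : Continuous zs := continuous_scalePath K hzc
  set π := prefixRungProj k N hkN with hπ
  set Yhat := SiteChain.langevinDrift P₀⟦lam, β, k⟧ (k + 1) with hYhat
  have hYhatc : Continuous Yhat :=
    (SiteChain.contDiff_one_langevinDrift _ (fun i => prefixLimit_contDiff_U lam β k i)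
      (fun i => prefixLimit_contDiff_V lam β k i) (k + 1)).continuous
  -- (a) the rescaled integral equation, projected on the cell block
  have hzsIE : ∀ σ ∈ Icc 0 Λ, zs σ = xs + ((0 : Fin N → ℝ), fun i => (K ^ 2)⁻¹ * η (σ / K) i) +
      ∫ r in (0 : ℝ)..σ, K⁻¹ • rescale K (Y (z (r / K))) := fun σ hσ =>
    scalePath_eq_of_integralEq hYc hK0 hzc hzIE hσ
  have hSc : Continuous fun r => K⁻¹ • rescale K (Y (z (r / K))) := by
    have h1 : Continuous fun r => rescale K (Y (z (r / K))) :=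
      (continuous_rescale K).comp (hYc.comp (hzc.comp (continuous_id.div_const K)))
    exact h1.const_smul K⁻¹
  have hπIE : ∀ σ ∈ Icc 0 Λ, π (zs σ) = π xs + π ((0 : Fin N → ℝ), fun i => (K ^ 2)⁻¹ * η (σ / K) i) +
      ∫ r in (0 : ℝ)..σ, π (K⁻¹ • rescale K (Y (z (r / K)))) := by
    intro σ hσ
    rw [hzsIE σ hσ, map_add, map_add, π.intervalIntegral_comp_comm (hSc.intervalIntegrable _ _)]
  -- (b) a-priori bounds along the window, membership in the region, the perturbation
  have hyb : ∀ σ ∈ Icc 0 Λ, P.hamiltonian N (z (σ / K) - ((0 : Fin N → ℝ), η (σ / K))) ≤ c₁ * K ^ 4 :=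
    fun σ hσ => hceil (σ / K) ⟨div_nonneg hσ.1 hK0.le, div_le_div_of_nonneg_right hσ.2 hK0.le⟩
  have hηb : ∀ σ ∈ Icc 0 Λ, ∀ i, |η (σ / K) i| ≤ δ₀ * K := fun σ hσ i => by
    have h := hM (σ / K) ⟨div_nonneg hσ.1 hK0.le, div_le_div_of_nonneg_right hσ.2 hK0.le⟩
    exact (Real.norm_eq_abs _ ▸ norm_le_pi_norm (η (σ / K)) i).trans h
  -- positions of `z` = positions of `y`
  have hzq : ∀ σ ∈ Icc 0 Λ, ∀ i : Fin N, (z (σ / K)).1 i = (z (σ / K) - ((0 : Fin N → ℝ), η (σ / K))).1 i :=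
    fun σ hσ i => by simp
  have hzp : ∀ σ ∈ Icc 0 Λ, ∀ i : Fin N, (z (σ / K)).2 i =
      (z (σ / K) - ((0 : Fin N → ℝ), η (σ / K))).2 i + η (σ / K) i := fun σ hσ i => by simp
  have hq : ∀ σ ∈ Icc 0 Λ, ∀ i : Fin N, i.val ≤ k → |(z (σ / K)).1 i| ≤ Cq * K := by
    intro σ hσ i hi
    rw [hzq σ hσ i]
    have h := prefixRung_abs_fst_le_of_hamiltonian_le hω.le hl hβ hk hK0 _ (hyb σ hσ) i hi
    refine h.trans (mul_le_mul_of_nonneg_right ?_ hK0.le)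
    have := le_max_left 1 (4 * h₀ / lam); have := le_max_left 1 (4 * h₀ / β)
    rw [hCq]; linarith
  have hh : ∀ σ ∈ Icc 0 Λ, ∀ i : Fin N, i.val = k + 1 → |(z (σ / K)).1 i| ≤ Ch * K ^ 2 := by
    intro σ hσ i _
    rw [hzq σ hσ i]
    exact prefixRung_abs_fst_host_le hω hl.le hβ.le hγ hK0 _ (hyb σ hσ) i
  have hp : ∀ σ ∈ Icc 0 Λ, ∀ i : Fin N, i.val ≤ k → |(z (σ / K)).2 i| ≤ Cp * K ^ 2 := by
    intro σ hσ i _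
    rw [hzp σ hσ i]
    have h1 := prefixRung_abs_snd_le hω hl.le hβ.le hγ hK0 _ (hyb σ hσ) i
    have h2 := hηb σ hσ i
    have hKK : K ≤ K ^ 2 := by nlinarith
    calc |(z (σ / K) - ((0 : Fin N → ℝ), η (σ / K))).2 i + η (σ / K) i|
        ≤ |(z (σ / K) - ((0 : Fin N → ℝ), η (σ / K))).2 i| + |η (σ / K) i| := abs_add_le _ _
      _ ≤ max 1 (2 * c₁) * K ^ 2 + δ₀ * K := add_le_add h1 h2
      _ ≤ max 1 (2 * c₁) * K ^ 2 + δ₀ * K ^ 2 := by gcongr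
      _ ≤ Cp * K ^ 2 := by
          have := le_max_left 1 (2 * h₀)
          rw [hCp]; nlinarith [sq_nonneg K]
  have hmem : ∀ σ ∈ Icc 0 Λ, π (zs σ) ∈ prefixRungRegion k Cp Cq := by
    intro σ hσ
    refine ⟨fun i => ?_, fun i => ?_⟩
    · rw [hπ, prefixRungProj_snd, hzs]
      simp only [scalePath, rescale_snd]
      have h := hp σ hσ (Fin.castLE hkN i) (Nat.lt_succ_iff.1 i.isLt)
      rw [abs_mul, abs_of_pos (by positivity : (0:ℝ) < (K ^ 2)⁻¹), ← div_eq_inv_mul, div_le_iff₀ (by positivity)]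
      exact h
    · rw [hπ, prefixRungProj_fst, hzs]
      simp only [scalePath, rescale_fst]
      have h := hq σ hσ (Fin.castLE hkN i) (Nat.lt_succ_iff.1 i.isLt)
      rw [abs_mul, abs_of_pos (by positivity : (0:ℝ) < K⁻¹), ← div_eq_inv_mul, div_le_iff₀ hK0]
      exact h
  have hpert : ∀ σ ∈ Icc 0 Λ, ‖π (K⁻¹ • rescale K (Y (z (σ / K)))) - Yhat (π (zs σ))‖ ≤ Cpert / K := by
    intro σ hσ
    have h := prefixRung_proj_scaledDrift_sub_limit_le (lam := lam) (β := β) k hω hl.le hβ.le hγ hkN hK1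
      hCq0 hCh0 hCp0 (z (σ / K)) (hq σ hσ) (hh σ hσ) (hp σ hσ)
    simpa only [hπ, hzs, scalePath, hY] using h
  -- (c) the projected rescaled path solves the limit equation with the forcing `G`
  have hπzsc : Continuous fun σ => π (zs σ) := π.continuous.comp hzsc
  have hFs : Continuous fun r => π (K⁻¹ • rescale K (Y (z (r / K)))) := π.continuous.comp hSc
  have hFh : Continuous fun r => Yhat (π (zs r)) := hYhatc.comp hπzsc
  set G : ℝ → PhaseSpace (k + 1) := fun σ => π xs + π ((0 : Fin N → ℝ), fun i => (K ^ 2)⁻¹ * η (σ / K) i) +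
    ∫ r in (0 : ℝ)..σ, (π (K⁻¹ • rescale K (Y (z (r / K)))) - Yhat (π (zs r))) with hG
  have hGIE : IsIntegralSolutionOn Yhat G (fun σ => π (zs σ)) Λ := by
    intro σ hσ
    rw [hG]
    simp only
    rw [intervalIntegral.integral_sub (hFs.intervalIntegrable _ _) (hFh.intervalIntegrable _ _), hπIE σ hσ]
    abel
  have hGδ : ∀ σ ∈ Icc 0 Λ, ‖G σ - π xs‖ ≤ (δ₀ + Λ * Cpert) / K := by
    intro σ hσ
    have e : G σ - π xs = π ((0 : Fin N → ℝ), fun i => (K ^ 2)⁻¹ * η (σ / K) i) +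
        ∫ r in (0 : ℝ)..σ, (π (K⁻¹ • rescale K (Y (z (r / K)))) - Yhat (π (zs r))) := by
      rw [hG]; simp only; abel
    rw [e]
    have h1 : ‖π (((0 : Fin N → ℝ), fun i => (K ^ 2)⁻¹ * η (σ / K) i) : PhaseSpace N)‖ ≤ δ₀ / K := by
      refine (norm_prefixRungProj_le k N hkN _).trans ?_
      rw [Prod.norm_def, norm_zero, max_le_iff]
      refine ⟨by positivity, (pi_norm_le_iff_of_nonneg (by positivity)).2 fun i => ?_⟩
      rw [Real.norm_eq_abs, abs_mul, abs_of_pos (by positivity : (0:ℝ) < (K ^ 2)⁻¹), ← div_eq_inv_mul,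
        div_le_iff₀ (by positivity)]
      calc |η (σ / K) i| ≤ δ₀ * K := hηb σ hσ i
        _ = δ₀ / K * K ^ 2 := by field_simp
    have h2 : ‖∫ r in (0 : ℝ)..σ, (π (K⁻¹ • rescale K (Y (z (r / K)))) - Yhat (π (zs r)))‖ ≤
        Cpert / K * |σ - 0| :=
      intervalIntegral.norm_integral_le_of_norm_le_const fun r hr => by
        rw [uIoc_of_le hσ.1] at hr
        exact hpert r ⟨hr.1.le, hr.2.trans hσ.2⟩
    rw [sub_zero, abs_of_nonneg hσ.1] at h2
    calc _ ≤ δ₀ / K + Cpert / K * σ := (norm_add_le _ _).trans (add_le_add h1 h2)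
      _ ≤ δ₀ / K + Cpert / K * Λ := by gcongr; exact hσ.2
      _ = (δ₀ + Λ * Cpert) / K := by ring
  -- (d) the reference solution: integral equation and region
  have hyhIE : IsIntegralSolutionOn Yhat (fun _ => π xs) yh Λ := by
    intro σ hσ
    have hint : IntervalIntegrable (fun r => Yhat (yh r)) volume 0 σ := (hYhatc.comp hyhc).intervalIntegrable _ _
    have h := intervalIntegral.integral_eq_sub_of_hasDerivAt_of_le hσ.1 hyhc.continuousOn
      (fun r hr => hyhd r ⟨hr.1, hr.2.trans_le hσ.2⟩) hint
    rw [h, hyh0]; abel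
  have hyhmem : ∀ σ ∈ Icc 0 Λ, yh σ ∈ prefixRungRegion k Cp Cq := by
    intro σ hσ
    refine ⟨fun i => ?_, fun i => ?_⟩
    · have h := prefixLimit_abs_snd_le k hl.le hβ.le (yh σ) (hyhE σ hσ) i
      refine h.trans ?_
      have := le_max_left 1 (2 * c₁); rw [hCp]; linarith
    · have h := prefixLimit_abs_fst_le k hl hβ hk (yh σ) (hyhE σ hσ) i
      refine h.trans ?_
      have := le_max_left 1 (4 * c₁ / lam); have := le_max_left 1 (4 * c₁ / β); rw [hCq]; linarith
  -- (e) Grönwall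
  have hLip := lipschitzOnWith_prefixLimit_drift k hl.le hβ.le Cp Cq
  have hclose : ∀ σ ∈ Icc 0 Λ, ‖π (zs σ) - yh σ‖ ≤ (δ₀ + Λ * Cpert) / K * Real.exp (L * Λ) := by
    intro σ hσ
    have h := IsIntegralSolutionOn.norm_sub_le_mul_exp hLip hGIE hyhIE hπzsc hyhc hmem hyhmem
      (δ := (δ₀ + Λ * Cpert) / K) (fun t ht => by simpa using hGδ t ht) σ hσ
    refine h.trans (mul_le_mul_of_nonneg_left ?_ (by positivity))
    rw [Real.coe_toNNReal _ hL0]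
    exact Real.exp_le_exp.2 (mul_le_mul_of_nonneg_left hσ.2 hL0)
  -- (f) transfer to the rescaled smooth left-bath momentum `K⁻² ȳ₀(σ/K)`
  set i0 : Fin N := ⟨0, by omega⟩ with hi0
  set j0 : Fin (k + 1) := ⟨0, Nat.succ_pos k⟩ with hj0
  have hcast : Fin.castLE hkN j0 = i0 := Fin.ext rfl
  set ys : ℝ → ℝ := fun σ => (K ^ 2)⁻¹ * (z (σ / K) - ((0 : Fin N → ℝ), η (σ / K))).2 i0 with hys
  have hΔ : ∀ σ ∈ Icc 0 Λ, |ys σ - (yh σ).2 j0| ≤ D₀ / K := by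
    intro σ hσ
    have h1 : |(π (zs σ)).2 j0 - ys σ| ≤ δ₀ / K := by
      have e : (π (zs σ)).2 j0 - ys σ = (K ^ 2)⁻¹ * η (σ / K) i0 := by
        rw [hπ, prefixRungProj_snd, hcast, hzs, hys]
        simp only [scalePath, rescale_snd, Prod.snd_sub, Pi.sub_apply]
        ring
      rw [e, abs_mul, abs_of_pos (by positivity : (0:ℝ) < (K ^ 2)⁻¹), ← div_eq_inv_mul,
        div_le_iff₀ (by positivity)]
      calc |η (σ / K) i0| ≤ δ₀ * K := hηb σ hσ i0
        _ = δ₀ / K * K ^ 2 := by field_simp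
    have h2 : |(π (zs σ)).2 j0 - (yh σ).2 j0| ≤ (δ₀ + Λ * Cpert) / K * Real.exp (L * Λ) := by
      have := hclose σ hσ
      calc |(π (zs σ)).2 j0 - (yh σ).2 j0| = |(π (zs σ) - yh σ).2 j0| := by simp
        _ ≤ ‖π (zs σ) - yh σ‖ := by
            rw [← Real.norm_eq_abs]; exact (norm_le_pi_norm (π (zs σ) - yh σ).2 j0).trans (norm_snd_le _)
        _ ≤ _ := this
    calc |ys σ - (yh σ).2 j0| = |((π (zs σ)).2 j0 - (yh σ).2 j0) - ((π (zs σ)).2 j0 - ys σ)| := by ring_nf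
      _ ≤ |(π (zs σ)).2 j0 - (yh σ).2 j0| + |(π (zs σ)).2 j0 - ys σ| := abs_sub _ _
      _ ≤ (δ₀ + Λ * Cpert) / K * Real.exp (L * Λ) + δ₀ / K := add_le_add h2 h1
      _ = D₀ / K := by rw [hD₀]; ring
  have hpt : ∀ σ ∈ Icc 0 Λ, (yh σ).2 j0 ^ 2 / 2 - (D₀ / K) ^ 2 ≤ ys σ ^ 2 := by
    intro σ hσ
    have h := half_sq_sub_sq_le (ys σ) ((yh σ).2 j0)
    have hd : (ys σ - (yh σ).2 j0) ^ 2 ≤ (D₀ / K) ^ 2 := by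
      rw [← sq_abs]; exact pow_le_pow_left₀ (abs_nonneg _) (hΔ σ hσ) 2
    linarith
  -- integrate over `[0, Λ]`
  have hysc : Continuous ys := by
    have hc1 : Continuous fun σ => z (σ / K) - ((0 : Fin N → ℝ), η (σ / K)) :=
      (hzc.comp (continuous_id.div_const K)).sub (continuous_const.prodMk (hη.comp (continuous_id.div_const K)))
    exact continuous_const.mul ((continuous_apply i0).comp (continuous_snd.comp hc1))
  have hlimc : Continuous fun σ => (yh σ).2 j0 ^ 2 := ((continuous_apply j0).comp (continuous_snd.comp hyhc)).pow 2
  have hint : ε₁ / 4 ≤ ∫ σ in (0 : ℝ)..Λ, ys σ ^ 2 := by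
    have h1 : ∫ σ in (0 : ℝ)..Λ, ((yh σ).2 j0 ^ 2 / 2 - (D₀ / K) ^ 2) ≤ ∫ σ in (0 : ℝ)..Λ, ys σ ^ 2 :=
      intervalIntegral.integral_mono_on hΛ.le
        (((hlimc.div_const _).sub continuous_const).intervalIntegrable _ _)
        ((hysc.pow 2).intervalIntegrable _ _) fun σ hσ => hpt σ hσ
    rw [intervalIntegral.integral_sub ((hlimc.div_const _).intervalIntegrable _ _)
      (continuous_const.intervalIntegrable _ _), intervalIntegral.integral_div,
      intervalIntegral.integral_const, sub_zero, smul_eq_mul] at h1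
    -- `Λ (D₀/K)² ≤ ε₁/4` from `K ≥ 8ΛD₀²/ε₁ + 1 ≥ 1`
    have h3 : Λ * (D₀ / K) ^ 2 ≤ ε₁ / 4 := by
      have hK2 : K ≤ K ^ 2 := by nlinarith only [hK1]
      have h4 : 8 * Λ * D₀ ^ 2 ≤ ε₁ * K := by
        have := mul_le_mul_of_nonneg_left hKD hε₁.le
        rwa [mul_div_cancel₀ _ hε₁.ne'] at this
      have h6 : ε₁ * K ≤ ε₁ * K ^ 2 := mul_le_mul_of_nonneg_left hK2 hε₁.le
      rw [div_pow]
      have h5 : Λ * (D₀ ^ 2 / K ^ 2) = Λ * D₀ ^ 2 / K ^ 2 := by ring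
      rw [h5, div_le_iff₀ (by positivity)]
      nlinarith only [h4, h6, hΛ, hD₀0]
    linarith only [h1, h3, hdiss]
  -- (g) back to the original time: `∫₀^{Λ/K} ȳ₀² = K³ ∫₀^Λ (K⁻²ȳ₀(σ/K))²`
  have hunscale : ∫ s in (0 : ℝ)..Λ / K, (z s - ((0 : Fin N → ℝ), η s)).2 i0 ^ 2 =
      K ^ 3 * ∫ σ in (0 : ℝ)..Λ, ys σ ^ 2 := by
    have h1 : ∀ σ, ys σ ^ 2 = (K ^ 4)⁻¹ * (z (σ / K) - ((0 : Fin N → ℝ), η (σ / K))).2 i0 ^ 2 := by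
      intro σ
      simp only [hys]
      have : (K ^ 4)⁻¹ = (K ^ 2)⁻¹ * (K ^ 2)⁻¹ := by rw [← mul_inv, ← pow_add]
      rw [this]; ring
    simp_rw [h1]
    rw [intervalIntegral.integral_const_mul,
      intervalIntegral.integral_comp_div (fun s => (z s - ((0 : Fin N → ℝ), η s)).2 i0 ^ 2) hK0.ne',
      zero_div, smul_eq_mul]
    field_simp
  rw [hunscale]
  have hK3 : 0 ≤ K ^ 3 := by positivity
  calc ε₁ / 4 * K ^ 3 = K ^ 3 * (ε₁ / 4) := by ring
    _ ≤ K ^ 3 * ∫ σ in (0 : ℝ)..Λ, ys σ ^ 2 := mul_le_mul_of_nonneg_left hint hK3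

end Closeness

end Literature.MathematicalPhysics.KineticTheory.HeatConduction
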